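import Summits.BirchSwinnertonDyer.Rank1Residual.X11b.BDPValueRigidity
import Summits.BirchSwinnertonDyer.Rank1Residual.X11b.Three.CharTorsionClasswide
import HarnessLib

/-!
# X11b @ `p = 3` — VALUE-AT-𝟙 RIGIDITY, the READINGS (S27 'V1RIG' §2-at-3, LW-H12FRAME): STEP L at 3
# from the ∃∧ input "ONE frame with interpolation ∧ value at 𝟙" + H3 (CTL₀ class-wide), and the
# ∀-frame H2 `Three.BDPValueAt₃ W` from the ∃∧ input + a character supply — the rigidity input being
# the THEOREM `constantCoeff_eq_of_isBDPLFunction_of_supply` (`X11b/BDPValueRigidity.lean`)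

HONEST FRAMING (cell `b2b-bsdres`, run/shared/lean/b2b/bsd-rank1-residual/, verbatim in every
file): the goal of the cell is to DELETE the COMBINATION-SHAPED residual classes of the
Birch–Swinnerton-Dyer formula for ALL analytic-rank `≤ 1` elliptic curves over `ℚ` — "full BSD
formula for every rank `≤ 1` curve in class `C`" assembled STRICTLY from published theorems — so
that the rank-`≤ 1` remainder becomes exactly the CONSTRUCTION-SHAPED classes, which are TYPED
(missing-input `Prop`s), NOT attempted. This is not "finishing BSD". Team `x11b3` (N8/O2), deal S27
'V1RIG' (x11b3-lead GEN 7 R8-14 (e)); the three readings of §1 are route planner 1's V1RIG-SKETCH §3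
(9d18b197ebdae999), ported VERBATIM (proved there against the tree); §2 is her §4 with the rigidity
binder `hrig` DISCHARGED by STEP 2 (seat `b2b-bsdres-x11b3-p3`). THEOREMS ONLY (no definition, no
named fact, no `sorry`). A READING beside the HALVES reading of record (`Three.stepLAt_of_halves₃`,
`…_of_classX11b`), never replacing it (R8-5 rule); H2 at `3 ‖ N` is not in print and is NOT
discharged here; H3's cross-period (divisibility) rigidity is NOT claimed; nothing is booked; no
mark / label / count moves; O2 OPEN; X11 ∧ r = 1 ∧ p = 3 CONSTRUCTION-SHAPED (R6.2).

## What is kernel-checked here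

* §1 `frameValue₃_of_exists_of_value` — (∃-frame H1 `BDPExistsAt₃`) ∧ (∀-frame H2 `BDPValueAt₃`) ⟹
  the ∃∧ input "SOME `ι'` inducing `𝔭` and ONE frame with interpolation ∧ value at `𝟙`" (trivial
  calibration); `stepLAt_of_frameValue₃` — `exists_isNewformOf ∧ CTL₀@3 ∧ (∃∧ input) ∧ H3 ⟹
  Three.StepLAt W` (the HALVES pointwise assembly at the supplied frame);
  `stepLAt_of_frameValue₃_of_classX11b` — the same with CTL₀ DISCHARGED class-wide
  (`Three.charTorsionAt₃_of_classX11b`, p260706).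
* §2 **`bdpValueAt₃_of_frameValue_of_supply`** — the ∀-frame H2 of record `Three.BDPValueAt₃ W` from a
  character supply at every `(ι', κ, γ)` of S0's data (HYPOTHESIS `hsup`: `m > 0`, `x₀` with
  `x₀^{3^k} → 1`, `≠ 1`, interpolation data of types `m·3^k`, `2m·3^k` with avatar values `x₀^{3^k}`,
  `x₀^{2·3^k}`) and the ∃∧ input in its `∀ ι'` form — S27's statement entering as the THEOREM
  `constantCoeff_eq_of_isBDPLFunction_of_supply`: two frames at the same `ι'` have the same `[T⁰]L`,
  so the value at `𝟙` of ONE frame is the value at `𝟙` of EVERY frame.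

References: [Castella2018] Thm. 3.1–3.2, §5 (arXiv:1704.06608 pp. 8–9, 12); [CastellaHsieh2018] §3.3.
-/

noncomputable section

open scoped Classical Topology

open Filter WeierstrassCurve NumberField IsDedekindDomain Field PowerSeries
  Literature.NumberTheory.EllipticCurves Literature.NumberTheory.EllipticCurves.ModularForms
  Literature.NumberTheory.EllipticCurves.Rank1Residual
  Literature.NumberTheory.GaloisRepresentations Literature.NumberTheory.GaloisCohomology
  Summit.BirchSwinnertonDyer.Rank1Residual.X11b.AcSelmer
  Summit.BirchSwinnertonDyer.Rank1Residual.X11b.CongruenceLimit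
  Summit.BirchSwinnertonDyer.Rank1Residual.X11b.Halves

/-! ### §1 LW-H12FRAME readings (route planner 1's V1RIG-SKETCH §3, verbatim) -/

namespace Summit.BirchSwinnertonDyer.Rank1Residual.X11b.Three

variable {W : WeierstrassCurve ℚ} [W.IsElliptic] [W.IsGloballyMinimal]

/-- §1(a) **Trivial calibration: (∃-frame H1 `BDPExistsAt₃`) ∧ (∀-frame H2 `BDPValueAt₃`) ⟹ the ∃∧
input "SOME `ι'` inducing `𝔭` and ONE frame with interpolation ∧ value at `𝟙`"** (take H1's frame and
apply H2 to it). So the ∃∧ input is AT MOST as strong as the pair (h1, h2) of `stepLAt_of_halves₃`.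
[folklore] -/
theorem frameValue₃_of_exists_of_value (h1 : BDPExistsAt₃ W) (h2 : BDPValueAt₃ W) :
    ∀ (N : ℕ) [NeZero N] (K : Type) [Field K] [NumberField K] (Dt : ModularParametrizationData W N)
    (H : HeegnerDatum N (NumberField.discr K)) (ι : K →+* ℂ) (P : (W.baseChange K).toAffine.Point),
    ClassX11b W 3 → Surj W 3 → W.conductorNorm ℤ = N → IsImaginaryQuadratic K →
    Odd (NumberField.discr K) → SatisfiesHeegnerHypothesis N K →
    (W.quadraticTwist (NumberField.discr K : ℚ)).entireLFunction 1 ≠ 0 →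
    WeierstrassCurve.Affine.Point.map ι.toRatAlgHom P = heegnerPointComplex Dt H →
    ¬ (3 : ℤ) ∣ Dt.c → ¬ IsOfFinAddOrder P →
    ∀ (κ : ZpExtension K 3), κ.IsAnticyclotomic →
      ∀ (γ : Field.absoluteGaloisGroup K) [Fact (κ.IsTopGenerator γ)]
        (𝔭 : HeightOneSpectrum (𝓞 K)) (h𝔭 : ((3 : ℕ) : 𝓞 K) ∈ 𝔭.asIdeal)
        (he : 𝔭.asIdeal.ramificationIdx (𝓞 ℚ) = 1) (hf : 𝔭.asIdeal.inertiaDeg (𝓞 ℚ) = 1),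
        ∀ (f : CuspForm (CongruenceSubgroup.Gamma0 N) 2), IsNewformOf W f →
          ∃ ι' : PadicAlgCl 3 ≃+* ℂ, InducesPrime ι' 𝔭 ∧
            ∃ (ΩK : ℂ) (Ωp : (unrIntegers 3)ˣ) (L : UnrSeries 3),
              ΩK ≠ 0 ∧ IsBDPLFunction ι' 𝔭 κ γ f ΩK ((Ωp : unrIntegers 3) : ℂ_[3]) L ∧
              ∃ u : (unrIntegers 3)ˣ, L.HasValueAt 0 (((u : unrIntegers 3) : ℂ_[3]) *
                (algebraMap ℚ_[3] ℂ_[3] (((1 : ℚ_[3]) - ((W.LFunction 3 : ℤ) : ℚ_[3]) * (3 : ℚ_[3])⁻¹) *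
                  logOmega W 3 (embAt K 3 𝔭 h𝔭 he hf) P)) ^ 2) := by
  intro N _ K _ _ Dt H ι P hX hsurj hN hK hodd hheeg hL1 hP hc hP0 κ hκ γ _ 𝔭 h𝔭 he hf f hfW
  obtain ⟨ι', hι', ΩK, Ωp, L, hΩK, hL⟩ :=
    h1 N K Dt H ι P hX hsurj hN hK hodd hheeg hL1 hP hc hP0 κ hκ γ 𝔭 h𝔭 he hf f hfW
  obtain ⟨u, hu⟩ :=
    h2 N K Dt H ι P hX hsurj hN hK hodd hheeg hL1 hP hc hP0 κ hκ γ 𝔭 h𝔭 he hf f hfW ι' hι' ΩK Ωp L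
      hΩK hL
  exact ⟨ι', hι', ΩK, Ωp, L, hΩK, hL, u, hu⟩

section Readings

/- The ∃∧ input (H1-style `∃ ι'`), INLINE as a section hypothesis (no def, R8-14 (e)). -/
variable (h12 : ∀ (N : ℕ) [NeZero N] (K : Type) [Field K] [NumberField K] (Dt : ModularParametrizationData W N)
    (H : HeegnerDatum N (NumberField.discr K)) (ι : K →+* ℂ) (P : (W.baseChange K).toAffine.Point),
    ClassX11b W 3 → Surj W 3 → W.conductorNorm ℤ = N → IsImaginaryQuadratic K →
    Odd (NumberField.discr K) → SatisfiesHeegnerHypothesis N K →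
    (W.quadraticTwist (NumberField.discr K : ℚ)).entireLFunction 1 ≠ 0 →
    WeierstrassCurve.Affine.Point.map ι.toRatAlgHom P = heegnerPointComplex Dt H →
    ¬ (3 : ℤ) ∣ Dt.c → ¬ IsOfFinAddOrder P →
    ∀ (κ : ZpExtension K 3), κ.IsAnticyclotomic →
      ∀ (γ : Field.absoluteGaloisGroup K) [Fact (κ.IsTopGenerator γ)]
        (𝔭 : HeightOneSpectrum (𝓞 K)) (h𝔭 : ((3 : ℕ) : 𝓞 K) ∈ 𝔭.asIdeal)
        (he : 𝔭.asIdeal.ramificationIdx (𝓞 ℚ) = 1) (hf : 𝔭.asIdeal.inertiaDeg (𝓞 ℚ) = 1),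
        ∀ (f : CuspForm (CongruenceSubgroup.Gamma0 N) 2), IsNewformOf W f →
          ∃ ι' : PadicAlgCl 3 ≃+* ℂ, InducesPrime ι' 𝔭 ∧
            ∃ (ΩK : ℂ) (Ωp : (unrIntegers 3)ˣ) (L : UnrSeries 3),
              ΩK ≠ 0 ∧ IsBDPLFunction ι' 𝔭 κ γ f ΩK ((Ωp : unrIntegers 3) : ℂ_[3]) L ∧
              ∃ u : (unrIntegers 3)ˣ, L.HasValueAt 0 (((u : unrIntegers 3) : ℂ_[3]) *
                (algebraMap ℚ_[3] ℂ_[3] (((1 : ℚ_[3]) - ((W.LFunction 3 : ℤ) : ℚ_[3]) * (3 : ℚ_[3])⁻¹) *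
                  logOmega W 3 (embAt K 3 𝔭 h𝔭 he hf) P)) ^ 2))

include h12 in
/-- §1(b) **LW-H12FRAME reading of STEP L at 3: `exists_isNewformOf ∧ CTL₀@3 ∧ (∃∧ input) ∧ H3 ⟹
Three.StepLAt W`.** The HALVES pointwise assembly (`imcLowerWaldspurgerOnTreeAt_of_value_of_dvd`) run at
the supplied frame; H3 (∀-frame) is instantiated there. A READING beside `Three.stepLAt_of_halves₃`,
never replacing it. Nothing asserted: all antecedents are hypotheses.
[cite: Castella2018, §5 (arXiv:1704.06608 p. 12) (assembly shape at p ∣ N; inputs typed, not asserted)] -/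
theorem stepLAt_of_frameValue₃ (hnf : exists_isNewformOf) (hctl : CharTorsionAt₃ W)
    (h3 : IMCDivAt₃ W) : StepLAt W := by
  intro N _ K _ _ Dt H ι P hX hsurj hN hK hodd hheeg hL1 hP hc hP0 κ hκ γ _ 𝔭 h𝔭 he hf
  subst hN
  obtain ⟨f, hfW⟩ := hnf W
  obtain ⟨ι', hι', ΩK, Ωp, L, hΩK, hL, u, hu⟩ :=
    h12 _ K Dt H ι P hX hsurj rfl hK hodd hheeg hL1 hP hc hP0 κ hκ γ 𝔭 h𝔭 he hf f hfW
  have hdiv :=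
    h3 _ K Dt H ι P hX hsurj rfl hK hodd hheeg hL1 hP hc hP0 κ hκ γ 𝔭 h𝔭 he hf f hfW ι' hι' ΩK Ωp L
      hΩK hL
  obtain ⟨n, hn⟩ := hctl _ K Dt H ι P hX hsurj rfl hK hodd hheeg hL1 hP hc hP0 κ hκ γ 𝔭 h𝔭 he hf
  exact imcLowerWaldspurgerOnTreeAt_of_value_of_dvd hn hdiv u (W.LFunction 3) hu

include h12 in
/-- §1(c) **The same reading CLASS-WIDE without a CTL₀ clause** (R8-5: CTL₀ is a theorem on the class,
`Three.charTorsionAt₃_of_classX11b`, from Kolyvagin + Poitou–Tate + local Euler–Poincaré BY NAME).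
[cite: Castella2018, §5 (arXiv:1704.06608 p. 12) (assembly shape at p ∣ N; inputs typed, not asserted)] -/
theorem stepLAt_of_frameValue₃_of_classX11b (hnf : exists_isNewformOf)
    (hKo : ∀ (N : ℕ) [NeZero N] (W : WeierstrassCurve ℚ) (K : Type) [Field K] [NumberField K],
      kolyvagin N W K)
    (hPT : ∀ (K : Type) [Field K] [NumberField K], poitouTate_sum_localTatePairing_eq_zero K)
    (hEP : ∀ (K : Type) [Field K] [NumberField K] (v : HeightOneSpectrum (𝓞 K)),
      localEulerPoincareCharacteristic (v.adicCompletion K))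
    (hX : ClassX11b W 3) (h3 : IMCDivAt₃ W) : StepLAt W :=
  stepLAt_of_frameValue₃ h12 hnf (charTorsionAt₃_of_classX11b hKo hPT hEP hX) h3

end Readings

/-- **What S27 buys at 3 (R8-14 (e) §2-at-3 shape), with the rigidity input DISCHARGED: the ∀-frame
H2 of record `Three.BDPValueAt₃ W` from a character supply at every `(ι', κ, γ)` of S0's data (binder
`hsup`, a separate clause — a HYPOTHESIS: the tree does not construct Hecke characters of prescribed
infinity type) and the ∃∧ input in its `∀ ι'` form (route p2's currency `P2.BDPValueOnTree`: for EVERY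
`ι'` inducing `𝔭`, ONE frame with interpolation ∧ value at `𝟙`).** Route planner 1's V1RIG-SKETCH §4
`bdpValueAt₃_of_frameValue_of_rigidity` with its binder `hrig` (the S27 statement) supplied by the
THEOREM `constantCoeff_eq_of_isBDPLFunction_of_supply` (`X11b/BDPValueRigidity.lean`, any `p`).
Hence reading (h1, h2) as one frame loses NOTHING given the supply. At a FIXED `ι'`: frames at
different embedding data are not compared. A READING beside the HALVES reading of record
(`Three.stepLAt_of_halves₃[_of_classX11b]`), never replacing it; discharges nothing at 3 by itself
(H2 at `3 ‖ N` is not in print). Nothing booked; O2 OPEN.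
[cite: Castella2018, Thm. 3.2 (arXiv:1704.06608 pp. 8–9) (shape only; nothing asserted)] -/
theorem bdpValueAt₃_of_frameValue_of_supply
    (hsup : ∀ (K : Type) [Field K] [NumberField K] (ι : PadicAlgCl 3 ≃+* ℂ) (κ : ZpExtension K 3)
      (γ : Field.absoluteGaloisGroup K), IsImaginaryQuadratic K → κ.IsAnticyclotomic →
      κ.IsTopGenerator γ →
      ∃ (m : ℕ) (x₀ : ℂ_[3]) (φ φ' : ℕ → HeckeCharacter K)
        (r r' : ℕ → FramedGaloisRep K (PadicAlgCl 3) 1),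
        0 < m ∧ (∀ k, x₀ ^ 3 ^ k ≠ 1) ∧ Tendsto (fun k ↦ x₀ ^ 3 ^ k) atTop (𝓝 1) ∧
        (∀ k (v : HeightOneSpectrum (𝓞 K)), (φ k).IsUnramifiedAt v) ∧
        (∀ k, (φ k).HasInfinityType (fun _ ↦ ((m * 3 ^ k : ℕ) : ℤ))
          (fun _ ↦ -((m * 3 ^ k : ℕ) : ℤ))) ∧
        (∀ k, IsPAdicAvatarOf ι (φ k) (r k)) ∧ (∀ k, FactorsThroughZp κ (r k)) ∧
        (∀ k, avatarValueAt (r k) γ = x₀ ^ 3 ^ k) ∧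
        (∀ k (v : HeightOneSpectrum (𝓞 K)), (φ' k).IsUnramifiedAt v) ∧
        (∀ k, (φ' k).HasInfinityType (fun _ ↦ ((2 * m * 3 ^ k : ℕ) : ℤ))
          (fun _ ↦ -((2 * m * 3 ^ k : ℕ) : ℤ))) ∧
        (∀ k, IsPAdicAvatarOf ι (φ' k) (r' k)) ∧ (∀ k, FactorsThroughZp κ (r' k)) ∧
        (∀ k, avatarValueAt (r' k) γ = x₀ ^ (2 * 3 ^ k)))
    (h12 : ∀ (N : ℕ) [NeZero N] (K : Type) [Field K] [NumberField K] (Dt : ModularParametrizationData W N)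
    (H : HeegnerDatum N (NumberField.discr K)) (ι : K →+* ℂ) (P : (W.baseChange K).toAffine.Point),
    ClassX11b W 3 → Surj W 3 → W.conductorNorm ℤ = N → IsImaginaryQuadratic K →
    Odd (NumberField.discr K) → SatisfiesHeegnerHypothesis N K →
    (W.quadraticTwist (NumberField.discr K : ℚ)).entireLFunction 1 ≠ 0 →
    WeierstrassCurve.Affine.Point.map ι.toRatAlgHom P = heegnerPointComplex Dt H →
    ¬ (3 : ℤ) ∣ Dt.c → ¬ IsOfFinAddOrder P →
    ∀ (κ : ZpExtension K 3), κ.IsAnticyclotomic →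
      ∀ (γ : Field.absoluteGaloisGroup K) [Fact (κ.IsTopGenerator γ)]
        (𝔭 : HeightOneSpectrum (𝓞 K)) (h𝔭 : ((3 : ℕ) : 𝓞 K) ∈ 𝔭.asIdeal)
        (he : 𝔭.asIdeal.ramificationIdx (𝓞 ℚ) = 1) (hf : 𝔭.asIdeal.inertiaDeg (𝓞 ℚ) = 1),
        ∀ (f : CuspForm (CongruenceSubgroup.Gamma0 N) 2), IsNewformOf W f →
          ∀ (ι' : PadicAlgCl 3 ≃+* ℂ), InducesPrime ι' 𝔭 →
            ∃ (ΩK : ℂ) (Ωp : (unrIntegers 3)ˣ) (L : UnrSeries 3),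
              ΩK ≠ 0 ∧ IsBDPLFunction ι' 𝔭 κ γ f ΩK ((Ωp : unrIntegers 3) : ℂ_[3]) L ∧
              ∃ u : (unrIntegers 3)ˣ, L.HasValueAt 0 (((u : unrIntegers 3) : ℂ_[3]) *
                (algebraMap ℚ_[3] ℂ_[3] (((1 : ℚ_[3]) - ((W.LFunction 3 : ℤ) : ℚ_[3]) * (3 : ℚ_[3])⁻¹) *
                  logOmega W 3 (embAt K 3 𝔭 h𝔭 he hf) P)) ^ 2)) :
    BDPValueAt₃ W := by
  intro N _ K _ _ Dt H ι P hX hsurj hN hK hodd hheeg hL1 hP hc hP0 κ hκ γ hγ 𝔭 h𝔭 he hf f hfW ι' hι'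
    ΩK' Ωp' L' hΩK' hL'
  obtain ⟨ΩK, Ωp, L, hΩK, hL, u, hu⟩ :=
    h12 N K Dt H ι P hX hsurj hN hK hodd hheeg hL1 hP hc hP0 κ hκ γ 𝔭 h𝔭 he hf f hfW ι' hι'
  have hΩp : ((Ωp : unrIntegers 3) : ℂ_[3]) ≠ 0 := by
    rw [Ne, ZeroMemClass.coe_eq_zero]
    exact Units.ne_zero Ωp
  have hΩp' : ((Ωp' : unrIntegers 3) : ℂ_[3]) ≠ 0 := by
    rw [Ne, ZeroMemClass.coe_eq_zero]
    exact Units.ne_zero Ωp'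
  obtain ⟨m, x₀, φ, φ', r, r', hm, hx1, hxlim, hunr, hinf, hr, hrκ, hval, hunr', hinf', hr', hrκ',
    hval'⟩ := hsup K ι' κ γ hK hκ hγ.out
  have key : PowerSeries.constantCoeff L' = PowerSeries.constantCoeff L :=
    constantCoeff_eq_of_isBDPLFunction_of_supply K N ι' 𝔭 κ γ f ΩK ΩK' _ _ L L' m x₀ φ φ' r r' hm
      hx1 hxlim hunr hinf hr hrκ hval hunr' hinf'
      hr' hrκ' hval' hΩK hΩK' hΩp hΩp' hL hL'
  refine ⟨u, ?_⟩
  rw [UnrSeries.eq_constantCoeff_of_hasValueAt_zero hu, ← key]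
  exact L'.hasValueAt_zero

end Summit.BirchSwinnertonDyer.Rank1Residual.X11b.Three

end
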